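import Summits.Ventures.PercRepro.C041ThreeExitCount

/-!
# ROW C-041 — THE THREE-EXIT ATTACHMENT, COUNTED (part 2): the fibre counts with at most one merged exit (p6,
gen 31; groundwork for the three-exit block map)

Setting of `C041ThreeExitCount`: the fibre `fib3` of an anchor class `(c1, c2, k)` over a colouring `ω`, and the
one-zone classes `cls`.  The nine remaining status patterns: one merged exit with the other two separated (joint
or apart: `card_fib3_s_m_s`, `card_fib3_s_m_joint`, `card_fib3_s_s_m`, `card_fib3_s_s_m_joint`), and no merged
exit — all three in one sub-zone (`card_fib3_joint3`), one pair joint and the third apart (`card_fib3_joint12`,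
`card_fib3_joint13`, `card_fib3_joint23`), all apart (`card_fib3_sss`).  A block of separated exits contributes
the inclusion–exclusion `∏ (F,T) + ∏ (T,F) − ∏ (T,T)` of its members' classes, an exit alone its `(F,F)` count.
-/

namespace PercRepro

namespace ZoneZ

namespace TwoExit

open ZoneData Pendant AnchorGlue Finset

variable {V₁ E₁ U₁ U₂ V E T₁ T₂ V' E' T₁' T₂' V'' E'' T₁'' T₂'' : Type}
variable (Z₁ : ZoneData V₁ E₁ U₁ U₂) (u u' u'' : V₁) (Z : ZoneData V E T₁ T₂) (a : V)
  (Z' : ZoneData V' E' T₁' T₂') (a' : V') (Z'' : ZoneData V'' E'' T₁'' T₂'') (a'' : V'') (a₁ : V₁)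
variable [Fintype E] [DecidableEq E] [Fintype T₁] [DecidableEq T₁]
  [Fintype T₂] [DecidableEq T₂] [Fintype E'] [DecidableEq E'] [Fintype T₁'] [DecidableEq T₁']
  [Fintype T₂'] [DecidableEq T₂'] [Fintype E''] [DecidableEq E''] [Fintype T₁''] [DecidableEq T₁'']
  [Fintype T₂''] [DecidableEq T₂'']

/-- **`u'` merged, `u`, `u''` separated and apart**. -/
theorem card_fib3_s_m_s (ω : E₁ → Bool) (hm : ¬ Z₁.Mg a₁ u ω) (hm' : Z₁.Mg a₁ u' ω) (hm'' : ¬ Z₁.Mg a₁ u'' ω)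
    (hbc'' : ¬ Z₁.Mg u'' u ω) (c1 c2 k : Bool) :
    #(fib3 Z₁ u u' u'' Z a Z' a' Z'' a'' a₁ ω c1 c2 k) =
      #(cls Z' a' c1 c2 k (Z₁.Rd a₁ u' ω)) * (#(cls Z a false false k (Z₁.Rd a₁ u ω)) *
        #(cls Z'' a'' false false k (Z₁.Rd a₁ u'' ω))) := by
  have hbc := not_Mg_exits_of_sep_merged Z₁ u u' a₁ ω hm hm'
  have hbc' := not_Mg_exits_of_sep_merged Z₁ u'' u' a₁ ω hm'' hm'
  have e : fib3 Z₁ u u' u'' Z a Z' a' Z'' a'' a₁ ω c1 c2 k =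
      cls Z' a' c1 c2 k (Z₁.Rd a₁ u' ω) ×ˢ (cls Z a false false k (Z₁.Rd a₁ u ω) ×ˢ
        cls Z'' a'' false false k (Z₁.Rd a₁ u'' ω)) := by
    ext p
    rw [mem_fib3, Finset.mem_product, Finset.mem_product, mem_cls, mem_cls, mem_cls]
    simp only [fibCond3, hm, hm', hm'', hbc, hbc', hbc'', and_true, and_false, false_or,
      Bool.false_eq_true, false_implies, true_and]
    have h1 := Z'.not_mem_D_of_mem_D2 a' p.1
    have h2 := Z.not_mem_D_of_mem_D2 a p.2.1
    have h3 := Z''.not_mem_D_of_mem_D2 a'' p.2.2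
    aesop
  rw [e, Finset.card_product, Finset.card_product]

/-- **`u'` merged, `u`, `u''` separated in ONE sub-zone**: inclusion–exclusion of the block `{u, u''}`. -/
theorem card_fib3_s_m_joint (ω : E₁ → Bool) (hm : ¬ Z₁.Mg a₁ u ω) (hm' : Z₁.Mg a₁ u' ω)
    (hm'' : ¬ Z₁.Mg a₁ u'' ω) (hbc'' : Z₁.Mg u'' u ω) (c1 c2 k : Bool) :
    #(fib3 Z₁ u u' u'' Z a Z' a' Z'' a'' a₁ ω c1 c2 k) +
        #(cls Z' a' c1 c2 k (Z₁.Rd a₁ u' ω)) * (#(cls Z a true true k (Z₁.Rd a₁ u ω)) *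
          #(cls Z'' a'' true true k (Z₁.Rd a₁ u'' ω))) =
      #(cls Z' a' c1 c2 k (Z₁.Rd a₁ u' ω)) * (#(cls Z a false true k (Z₁.Rd a₁ u ω)) *
          #(cls Z'' a'' false true k (Z₁.Rd a₁ u'' ω))) +
        #(cls Z' a' c1 c2 k (Z₁.Rd a₁ u' ω)) * (#(cls Z a true false k (Z₁.Rd a₁ u ω)) *
          #(cls Z'' a'' true false k (Z₁.Rd a₁ u'' ω))) := by
  classical
  have hbc := not_Mg_exits_of_sep_merged Z₁ u u' a₁ ω hm hm'
  have hbc' := not_Mg_exits_of_sep_merged Z₁ u'' u' a₁ ω hm'' hm'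
  have e : fib3 Z₁ u u' u'' Z a Z' a' Z'' a'' a₁ ω c1 c2 k =
      cls Z' a' c1 c2 k (Z₁.Rd a₁ u' ω) ×ˢ (cls Z a false true k (Z₁.Rd a₁ u ω) ×ˢ
          cls Z'' a'' false true k (Z₁.Rd a₁ u'' ω)) ∪
        cls Z' a' c1 c2 k (Z₁.Rd a₁ u' ω) ×ˢ (cls Z a true false k (Z₁.Rd a₁ u ω) ×ˢ
          cls Z'' a'' true false k (Z₁.Rd a₁ u'' ω)) := by
    ext p
    rw [mem_fib3, Finset.mem_union, Finset.mem_product, Finset.mem_product, Finset.mem_product,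
      Finset.mem_product]
    simp only [mem_cls]
    simp only [fibCond3, hm, hm', hm'', hbc, hbc', hbc'', and_true, and_false, false_or,
      Bool.false_eq_true, false_implies, true_and, true_implies]
    have h1 := Z'.not_mem_D_of_mem_D2 a' p.1
    have h2 := Z.not_mem_D_of_mem_D2 a p.2.1
    have h3 := Z''.not_mem_D_of_mem_D2 a'' p.2.2
    rcases Classical.em (a ∈ Z.D p.2.1) with hD | hD <;> rcases Classical.em (a'' ∈ Z''.D p.2.2) with hD'' | hD'' <;>
      aesop
  have e2 : cls Z' a' c1 c2 k (Z₁.Rd a₁ u' ω) ×ˢ (cls Z a false true k (Z₁.Rd a₁ u ω) ×ˢ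
          cls Z'' a'' false true k (Z₁.Rd a₁ u'' ω)) ∩
        cls Z' a' c1 c2 k (Z₁.Rd a₁ u' ω) ×ˢ (cls Z a true false k (Z₁.Rd a₁ u ω) ×ˢ
          cls Z'' a'' true false k (Z₁.Rd a₁ u'' ω)) =
      cls Z' a' c1 c2 k (Z₁.Rd a₁ u' ω) ×ˢ (cls Z a true true k (Z₁.Rd a₁ u ω) ×ˢ
          cls Z'' a'' true true k (Z₁.Rd a₁ u'' ω)) := by
    ext p
    rw [Finset.mem_inter, Finset.mem_product, Finset.mem_product, Finset.mem_product, Finset.mem_product,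
      Finset.mem_product, Finset.mem_product]
    simp only [mem_cls, Bool.false_eq_true, false_implies, true_implies, true_and]
    tauto
  rw [e, ← Finset.card_product, ← Finset.card_product, ← Finset.card_product, ← Finset.card_product,
    ← Finset.card_product, ← Finset.card_product, ← e2, Finset.card_union_add_card_inter]

/-- **`u''` merged, `u`, `u'` separated and apart**. -/
theorem card_fib3_s_s_m (ω : E₁ → Bool) (hm : ¬ Z₁.Mg a₁ u ω) (hm' : ¬ Z₁.Mg a₁ u' ω) (hm'' : Z₁.Mg a₁ u'' ω)
    (hbc : ¬ Z₁.Mg u u' ω) (c1 c2 k : Bool) :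
    #(fib3 Z₁ u u' u'' Z a Z' a' Z'' a'' a₁ ω c1 c2 k) =
      #(cls Z' a' false false k (Z₁.Rd a₁ u' ω)) * (#(cls Z a false false k (Z₁.Rd a₁ u ω)) *
        #(cls Z'' a'' c1 c2 k (Z₁.Rd a₁ u'' ω))) := by
  have hbc' := not_Mg_exits_of_merged_sep Z₁ u'' u' a₁ ω hm'' hm'
  have hbc'' := not_Mg_exits_of_merged_sep Z₁ u'' u a₁ ω hm'' hm
  have e : fib3 Z₁ u u' u'' Z a Z' a' Z'' a'' a₁ ω c1 c2 k =
      cls Z' a' false false k (Z₁.Rd a₁ u' ω) ×ˢ (cls Z a false false k (Z₁.Rd a₁ u ω) ×ˢ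
        cls Z'' a'' c1 c2 k (Z₁.Rd a₁ u'' ω)) := by
    ext p
    rw [mem_fib3, Finset.mem_product, Finset.mem_product, mem_cls, mem_cls, mem_cls]
    simp only [fibCond3, hm, hm', hm'', hbc, hbc', hbc'', and_true, and_false, false_or,
      Bool.false_eq_true, false_implies, true_and]
    have h1 := Z'.not_mem_D_of_mem_D2 a' p.1
    have h2 := Z.not_mem_D_of_mem_D2 a p.2.1
    have h3 := Z''.not_mem_D_of_mem_D2 a'' p.2.2
    aesop
  rw [e, Finset.card_product, Finset.card_product]

/-- **`u''` merged, `u`, `u'` separated in ONE sub-zone**: inclusion–exclusion of the block `{u, u'}`. -/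
theorem card_fib3_s_s_m_joint (ω : E₁ → Bool) (hm : ¬ Z₁.Mg a₁ u ω) (hm' : ¬ Z₁.Mg a₁ u' ω)
    (hm'' : Z₁.Mg a₁ u'' ω) (hbc : Z₁.Mg u u' ω) (c1 c2 k : Bool) :
    #(fib3 Z₁ u u' u'' Z a Z' a' Z'' a'' a₁ ω c1 c2 k) +
        #(cls Z' a' true true k (Z₁.Rd a₁ u' ω)) * (#(cls Z a true true k (Z₁.Rd a₁ u ω)) *
          #(cls Z'' a'' c1 c2 k (Z₁.Rd a₁ u'' ω))) =
      #(cls Z' a' false true k (Z₁.Rd a₁ u' ω)) * (#(cls Z a false true k (Z₁.Rd a₁ u ω)) *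
          #(cls Z'' a'' c1 c2 k (Z₁.Rd a₁ u'' ω))) +
        #(cls Z' a' true false k (Z₁.Rd a₁ u' ω)) * (#(cls Z a true false k (Z₁.Rd a₁ u ω)) *
          #(cls Z'' a'' c1 c2 k (Z₁.Rd a₁ u'' ω))) := by
  classical
  have hbc' := not_Mg_exits_of_merged_sep Z₁ u'' u' a₁ ω hm'' hm'
  have hbc'' := not_Mg_exits_of_merged_sep Z₁ u'' u a₁ ω hm'' hm
  have e : fib3 Z₁ u u' u'' Z a Z' a' Z'' a'' a₁ ω c1 c2 k =
      cls Z' a' false true k (Z₁.Rd a₁ u' ω) ×ˢ (cls Z a false true k (Z₁.Rd a₁ u ω) ×ˢ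
          cls Z'' a'' c1 c2 k (Z₁.Rd a₁ u'' ω)) ∪
        cls Z' a' true false k (Z₁.Rd a₁ u' ω) ×ˢ (cls Z a true false k (Z₁.Rd a₁ u ω) ×ˢ
          cls Z'' a'' c1 c2 k (Z₁.Rd a₁ u'' ω)) := by
    ext p
    rw [mem_fib3, Finset.mem_union, Finset.mem_product, Finset.mem_product, Finset.mem_product,
      Finset.mem_product]
    simp only [mem_cls]
    simp only [fibCond3, hm, hm', hm'', hbc, hbc', hbc'', and_true, and_false, false_or,
      Bool.false_eq_true, false_implies, true_and, true_implies]
    have h1 := Z'.not_mem_D_of_mem_D2 a' p.1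
    have h2 := Z.not_mem_D_of_mem_D2 a p.2.1
    have h3 := Z''.not_mem_D_of_mem_D2 a'' p.2.2
    rcases Classical.em (a' ∈ Z'.D p.1) with hD' | hD' <;> rcases Classical.em (a ∈ Z.D p.2.1) with hD | hD <;>
      aesop
  have e2 : cls Z' a' false true k (Z₁.Rd a₁ u' ω) ×ˢ (cls Z a false true k (Z₁.Rd a₁ u ω) ×ˢ
          cls Z'' a'' c1 c2 k (Z₁.Rd a₁ u'' ω)) ∩
        cls Z' a' true false k (Z₁.Rd a₁ u' ω) ×ˢ (cls Z a true false k (Z₁.Rd a₁ u ω) ×ˢ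
          cls Z'' a'' c1 c2 k (Z₁.Rd a₁ u'' ω)) =
      cls Z' a' true true k (Z₁.Rd a₁ u' ω) ×ˢ (cls Z a true true k (Z₁.Rd a₁ u ω) ×ˢ
          cls Z'' a'' c1 c2 k (Z₁.Rd a₁ u'' ω)) := by
    ext p
    rw [Finset.mem_inter, Finset.mem_product, Finset.mem_product, Finset.mem_product, Finset.mem_product,
      Finset.mem_product, Finset.mem_product]
    simp only [mem_cls, Bool.false_eq_true, false_implies, true_implies, true_and]
    tauto
  rw [e, ← Finset.card_product, ← Finset.card_product, ← Finset.card_product, ← Finset.card_product,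
    ← Finset.card_product, ← Finset.card_product, ← e2, Finset.card_union_add_card_inter]

/-- **No exit merged, all three apart**. -/
theorem card_fib3_sss (ω : E₁ → Bool) (hm : ¬ Z₁.Mg a₁ u ω) (hm' : ¬ Z₁.Mg a₁ u' ω) (hm'' : ¬ Z₁.Mg a₁ u'' ω)
    (hbc : ¬ Z₁.Mg u u' ω) (hbc' : ¬ Z₁.Mg u'' u' ω) (hbc'' : ¬ Z₁.Mg u'' u ω) (c1 c2 k : Bool) :
    #(fib3 Z₁ u u' u'' Z a Z' a' Z'' a'' a₁ ω c1 c2 k) =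
      #(cls Z' a' false false k (Z₁.Rd a₁ u' ω)) * (#(cls Z a false false k (Z₁.Rd a₁ u ω)) *
        #(cls Z'' a'' false false k (Z₁.Rd a₁ u'' ω))) := by
  have e : fib3 Z₁ u u' u'' Z a Z' a' Z'' a'' a₁ ω c1 c2 k =
      cls Z' a' false false k (Z₁.Rd a₁ u' ω) ×ˢ (cls Z a false false k (Z₁.Rd a₁ u ω) ×ˢ
        cls Z'' a'' false false k (Z₁.Rd a₁ u'' ω)) := by
    ext p
    rw [mem_fib3, Finset.mem_product, Finset.mem_product, mem_cls, mem_cls, mem_cls]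
    simp only [fibCond3, hm, hm', hm'', hbc, hbc', hbc'', and_false, false_or, or_false, Bool.false_eq_true,
      false_implies, true_and, not_false_eq_true, implies_true]
    have h1 := Z'.not_mem_D_of_mem_D2 a' p.1
    have h2 := Z.not_mem_D_of_mem_D2 a p.2.1
    have h3 := Z''.not_mem_D_of_mem_D2 a'' p.2.2
    aesop
  rw [e, Finset.card_product, Finset.card_product]

/-- **No exit merged, `u`, `u'` in one sub-zone, `u''` apart**. -/
theorem card_fib3_joint12 (ω : E₁ → Bool) (hm : ¬ Z₁.Mg a₁ u ω) (hm' : ¬ Z₁.Mg a₁ u' ω)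
    (hm'' : ¬ Z₁.Mg a₁ u'' ω) (hbc : Z₁.Mg u u' ω) (hbc' : ¬ Z₁.Mg u'' u' ω) (hbc'' : ¬ Z₁.Mg u'' u ω)
    (c1 c2 k : Bool) :
    #(fib3 Z₁ u u' u'' Z a Z' a' Z'' a'' a₁ ω c1 c2 k) +
        #(cls Z' a' true true k (Z₁.Rd a₁ u' ω)) * (#(cls Z a true true k (Z₁.Rd a₁ u ω)) *
          #(cls Z'' a'' false false k (Z₁.Rd a₁ u'' ω))) =
      #(cls Z' a' false true k (Z₁.Rd a₁ u' ω)) * (#(cls Z a false true k (Z₁.Rd a₁ u ω)) *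
          #(cls Z'' a'' false false k (Z₁.Rd a₁ u'' ω))) +
        #(cls Z' a' true false k (Z₁.Rd a₁ u' ω)) * (#(cls Z a true false k (Z₁.Rd a₁ u ω)) *
          #(cls Z'' a'' false false k (Z₁.Rd a₁ u'' ω))) := by
  classical
  have e : fib3 Z₁ u u' u'' Z a Z' a' Z'' a'' a₁ ω c1 c2 k =
      cls Z' a' false true k (Z₁.Rd a₁ u' ω) ×ˢ (cls Z a false true k (Z₁.Rd a₁ u ω) ×ˢ
          cls Z'' a'' false false k (Z₁.Rd a₁ u'' ω)) ∪
        cls Z' a' true false k (Z₁.Rd a₁ u' ω) ×ˢ (cls Z a true false k (Z₁.Rd a₁ u ω) ×ˢ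
          cls Z'' a'' false false k (Z₁.Rd a₁ u'' ω)) := by
    ext p
    rw [mem_fib3, Finset.mem_union, Finset.mem_product, Finset.mem_product, Finset.mem_product,
      Finset.mem_product]
    simp only [mem_cls]
    simp only [fibCond3, hm, hm', hm'', hbc, hbc', hbc'', and_true, and_false, false_or, or_false,
      Bool.false_eq_true, false_implies, true_and, true_implies, not_false_eq_true, implies_true]
    have h1 := Z'.not_mem_D_of_mem_D2 a' p.1
    have h2 := Z.not_mem_D_of_mem_D2 a p.2.1
    have h3 := Z''.not_mem_D_of_mem_D2 a'' p.2.2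
    rcases Classical.em (a' ∈ Z'.D p.1) with hD' | hD' <;> rcases Classical.em (a ∈ Z.D p.2.1) with hD | hD <;>
      aesop
  have e2 : cls Z' a' false true k (Z₁.Rd a₁ u' ω) ×ˢ (cls Z a false true k (Z₁.Rd a₁ u ω) ×ˢ
          cls Z'' a'' false false k (Z₁.Rd a₁ u'' ω)) ∩
        cls Z' a' true false k (Z₁.Rd a₁ u' ω) ×ˢ (cls Z a true false k (Z₁.Rd a₁ u ω) ×ˢ
          cls Z'' a'' false false k (Z₁.Rd a₁ u'' ω)) =
      cls Z' a' true true k (Z₁.Rd a₁ u' ω) ×ˢ (cls Z a true true k (Z₁.Rd a₁ u ω) ×ˢ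
          cls Z'' a'' false false k (Z₁.Rd a₁ u'' ω)) := by
    ext p
    rw [Finset.mem_inter, Finset.mem_product, Finset.mem_product, Finset.mem_product, Finset.mem_product,
      Finset.mem_product, Finset.mem_product]
    simp only [mem_cls, Bool.false_eq_true, false_implies, true_implies, true_and]
    tauto
  rw [e, ← Finset.card_product, ← Finset.card_product, ← Finset.card_product, ← Finset.card_product,
    ← Finset.card_product, ← Finset.card_product, ← e2, Finset.card_union_add_card_inter]

/-- **No exit merged, `u`, `u''` in one sub-zone, `u'` apart**. -/
theorem card_fib3_joint13 (ω : E₁ → Bool) (hm : ¬ Z₁.Mg a₁ u ω) (hm' : ¬ Z₁.Mg a₁ u' ω)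
    (hm'' : ¬ Z₁.Mg a₁ u'' ω) (hbc : ¬ Z₁.Mg u u' ω) (hbc' : ¬ Z₁.Mg u'' u' ω) (hbc'' : Z₁.Mg u'' u ω)
    (c1 c2 k : Bool) :
    #(fib3 Z₁ u u' u'' Z a Z' a' Z'' a'' a₁ ω c1 c2 k) +
        #(cls Z' a' false false k (Z₁.Rd a₁ u' ω)) * (#(cls Z a true true k (Z₁.Rd a₁ u ω)) *
          #(cls Z'' a'' true true k (Z₁.Rd a₁ u'' ω))) =
      #(cls Z' a' false false k (Z₁.Rd a₁ u' ω)) * (#(cls Z a false true k (Z₁.Rd a₁ u ω)) *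
          #(cls Z'' a'' false true k (Z₁.Rd a₁ u'' ω))) +
        #(cls Z' a' false false k (Z₁.Rd a₁ u' ω)) * (#(cls Z a true false k (Z₁.Rd a₁ u ω)) *
          #(cls Z'' a'' true false k (Z₁.Rd a₁ u'' ω))) := by
  classical
  have e : fib3 Z₁ u u' u'' Z a Z' a' Z'' a'' a₁ ω c1 c2 k =
      cls Z' a' false false k (Z₁.Rd a₁ u' ω) ×ˢ (cls Z a false true k (Z₁.Rd a₁ u ω) ×ˢ
          cls Z'' a'' false true k (Z₁.Rd a₁ u'' ω)) ∪
        cls Z' a' false false k (Z₁.Rd a₁ u' ω) ×ˢ (cls Z a true false k (Z₁.Rd a₁ u ω) ×ˢ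
          cls Z'' a'' true false k (Z₁.Rd a₁ u'' ω)) := by
    ext p
    rw [mem_fib3, Finset.mem_union, Finset.mem_product, Finset.mem_product, Finset.mem_product,
      Finset.mem_product]
    simp only [mem_cls]
    simp only [fibCond3, hm, hm', hm'', hbc, hbc', hbc'', and_true, and_false, false_or, or_false,
      Bool.false_eq_true, false_implies, true_and, true_implies, not_false_eq_true, implies_true]
    have h1 := Z'.not_mem_D_of_mem_D2 a' p.1
    have h2 := Z.not_mem_D_of_mem_D2 a p.2.1
    have h3 := Z''.not_mem_D_of_mem_D2 a'' p.2.2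
    rcases Classical.em (a ∈ Z.D p.2.1) with hD | hD <;> rcases Classical.em (a'' ∈ Z''.D p.2.2) with hD'' | hD'' <;>
      aesop
  have e2 : cls Z' a' false false k (Z₁.Rd a₁ u' ω) ×ˢ (cls Z a false true k (Z₁.Rd a₁ u ω) ×ˢ
          cls Z'' a'' false true k (Z₁.Rd a₁ u'' ω)) ∩
        cls Z' a' false false k (Z₁.Rd a₁ u' ω) ×ˢ (cls Z a true false k (Z₁.Rd a₁ u ω) ×ˢ
          cls Z'' a'' true false k (Z₁.Rd a₁ u'' ω)) =
      cls Z' a' false false k (Z₁.Rd a₁ u' ω) ×ˢ (cls Z a true true k (Z₁.Rd a₁ u ω) ×ˢ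
          cls Z'' a'' true true k (Z₁.Rd a₁ u'' ω)) := by
    ext p
    rw [Finset.mem_inter, Finset.mem_product, Finset.mem_product, Finset.mem_product, Finset.mem_product,
      Finset.mem_product, Finset.mem_product]
    simp only [mem_cls, Bool.false_eq_true, false_implies, true_implies, true_and]
    tauto
  rw [e, ← Finset.card_product, ← Finset.card_product, ← Finset.card_product, ← Finset.card_product,
    ← Finset.card_product, ← Finset.card_product, ← e2, Finset.card_union_add_card_inter]

/-- **No exit merged, `u'`, `u''` in one sub-zone, `u` apart**. -/
theorem card_fib3_joint23 (ω : E₁ → Bool) (hm : ¬ Z₁.Mg a₁ u ω) (hm' : ¬ Z₁.Mg a₁ u' ω)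
    (hm'' : ¬ Z₁.Mg a₁ u'' ω) (hbc : ¬ Z₁.Mg u u' ω) (hbc' : Z₁.Mg u'' u' ω) (hbc'' : ¬ Z₁.Mg u'' u ω)
    (c1 c2 k : Bool) :
    #(fib3 Z₁ u u' u'' Z a Z' a' Z'' a'' a₁ ω c1 c2 k) +
        #(cls Z' a' true true k (Z₁.Rd a₁ u' ω)) * (#(cls Z a false false k (Z₁.Rd a₁ u ω)) *
          #(cls Z'' a'' true true k (Z₁.Rd a₁ u'' ω))) =
      #(cls Z' a' false true k (Z₁.Rd a₁ u' ω)) * (#(cls Z a false false k (Z₁.Rd a₁ u ω)) *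
          #(cls Z'' a'' false true k (Z₁.Rd a₁ u'' ω))) +
        #(cls Z' a' true false k (Z₁.Rd a₁ u' ω)) * (#(cls Z a false false k (Z₁.Rd a₁ u ω)) *
          #(cls Z'' a'' true false k (Z₁.Rd a₁ u'' ω))) := by
  classical
  have e : fib3 Z₁ u u' u'' Z a Z' a' Z'' a'' a₁ ω c1 c2 k =
      cls Z' a' false true k (Z₁.Rd a₁ u' ω) ×ˢ (cls Z a false false k (Z₁.Rd a₁ u ω) ×ˢ
          cls Z'' a'' false true k (Z₁.Rd a₁ u'' ω)) ∪
        cls Z' a' true false k (Z₁.Rd a₁ u' ω) ×ˢ (cls Z a false false k (Z₁.Rd a₁ u ω) ×ˢ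
          cls Z'' a'' true false k (Z₁.Rd a₁ u'' ω)) := by
    ext p
    rw [mem_fib3, Finset.mem_union, Finset.mem_product, Finset.mem_product, Finset.mem_product,
      Finset.mem_product]
    simp only [mem_cls]
    simp only [fibCond3, hm, hm', hm'', hbc, hbc', hbc'', and_true, and_false, false_or, or_false,
      Bool.false_eq_true, false_implies, true_and, true_implies, not_false_eq_true, implies_true]
    have h1 := Z'.not_mem_D_of_mem_D2 a' p.1
    have h2 := Z.not_mem_D_of_mem_D2 a p.2.1
    have h3 := Z''.not_mem_D_of_mem_D2 a'' p.2.2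
    rcases Classical.em (a' ∈ Z'.D p.1) with hD' | hD' <;> rcases Classical.em (a'' ∈ Z''.D p.2.2) with hD'' | hD'' <;>
      aesop
  have e2 : cls Z' a' false true k (Z₁.Rd a₁ u' ω) ×ˢ (cls Z a false false k (Z₁.Rd a₁ u ω) ×ˢ
          cls Z'' a'' false true k (Z₁.Rd a₁ u'' ω)) ∩
        cls Z' a' true false k (Z₁.Rd a₁ u' ω) ×ˢ (cls Z a false false k (Z₁.Rd a₁ u ω) ×ˢ
          cls Z'' a'' true false k (Z₁.Rd a₁ u'' ω)) =
      cls Z' a' true true k (Z₁.Rd a₁ u' ω) ×ˢ (cls Z a false false k (Z₁.Rd a₁ u ω) ×ˢ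
          cls Z'' a'' true true k (Z₁.Rd a₁ u'' ω)) := by
    ext p
    rw [Finset.mem_inter, Finset.mem_product, Finset.mem_product, Finset.mem_product, Finset.mem_product,
      Finset.mem_product, Finset.mem_product]
    simp only [mem_cls, Bool.false_eq_true, false_implies, true_implies, true_and]
    tauto
  rw [e, ← Finset.card_product, ← Finset.card_product, ← Finset.card_product, ← Finset.card_product,
    ← Finset.card_product, ← Finset.card_product, ← e2, Finset.card_union_add_card_inter]

/-- **No exit merged, all three in ONE sub-zone**: inclusion–exclusion of the block `{u, u', u''}`. -/
theorem card_fib3_joint3 (ω : E₁ → Bool) (hm : ¬ Z₁.Mg a₁ u ω) (hm' : ¬ Z₁.Mg a₁ u' ω)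
    (hm'' : ¬ Z₁.Mg a₁ u'' ω) (hbc : Z₁.Mg u u' ω) (hbc' : Z₁.Mg u'' u' ω) (c1 c2 k : Bool) :
    #(fib3 Z₁ u u' u'' Z a Z' a' Z'' a'' a₁ ω c1 c2 k) +
        #(cls Z' a' true true k (Z₁.Rd a₁ u' ω)) * (#(cls Z a true true k (Z₁.Rd a₁ u ω)) *
          #(cls Z'' a'' true true k (Z₁.Rd a₁ u'' ω))) =
      #(cls Z' a' false true k (Z₁.Rd a₁ u' ω)) * (#(cls Z a false true k (Z₁.Rd a₁ u ω)) *
          #(cls Z'' a'' false true k (Z₁.Rd a₁ u'' ω))) +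
        #(cls Z' a' true false k (Z₁.Rd a₁ u' ω)) * (#(cls Z a true false k (Z₁.Rd a₁ u ω)) *
          #(cls Z'' a'' true false k (Z₁.Rd a₁ u'' ω))) := by
  classical
  have hbc'' : Z₁.Mg u'' u ω := Mg_trans Z₁ ω u'' u' u hbc' (Mg_symm Z₁ ω u u' hbc)
  have e : fib3 Z₁ u u' u'' Z a Z' a' Z'' a'' a₁ ω c1 c2 k =
      cls Z' a' false true k (Z₁.Rd a₁ u' ω) ×ˢ (cls Z a false true k (Z₁.Rd a₁ u ω) ×ˢ
          cls Z'' a'' false true k (Z₁.Rd a₁ u'' ω)) ∪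
        cls Z' a' true false k (Z₁.Rd a₁ u' ω) ×ˢ (cls Z a true false k (Z₁.Rd a₁ u ω) ×ˢ
          cls Z'' a'' true false k (Z₁.Rd a₁ u'' ω)) := by
    ext p
    rw [mem_fib3, Finset.mem_union, Finset.mem_product, Finset.mem_product, Finset.mem_product,
      Finset.mem_product]
    simp only [mem_cls]
    simp only [fibCond3, hm, hm', hm'', hbc, hbc', hbc'', and_true, and_false, or_false,
      Bool.false_eq_true, false_implies, true_and, true_implies, not_false_eq_true, implies_true]
    have h1 := Z'.not_mem_D_of_mem_D2 a' p.1
    have h2 := Z.not_mem_D_of_mem_D2 a p.2.1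
    have h3 := Z''.not_mem_D_of_mem_D2 a'' p.2.2
    rcases Classical.em (a' ∈ Z'.D p.1) with hD' | hD' <;> rcases Classical.em (a ∈ Z.D p.2.1) with hD | hD <;>
      rcases Classical.em (a'' ∈ Z''.D p.2.2) with hD'' | hD'' <;> aesop
  have e2 : cls Z' a' false true k (Z₁.Rd a₁ u' ω) ×ˢ (cls Z a false true k (Z₁.Rd a₁ u ω) ×ˢ
          cls Z'' a'' false true k (Z₁.Rd a₁ u'' ω)) ∩
        cls Z' a' true false k (Z₁.Rd a₁ u' ω) ×ˢ (cls Z a true false k (Z₁.Rd a₁ u ω) ×ˢ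
          cls Z'' a'' true false k (Z₁.Rd a₁ u'' ω)) =
      cls Z' a' true true k (Z₁.Rd a₁ u' ω) ×ˢ (cls Z a true true k (Z₁.Rd a₁ u ω) ×ˢ
          cls Z'' a'' true true k (Z₁.Rd a₁ u'' ω)) := by
    ext p
    rw [Finset.mem_inter, Finset.mem_product, Finset.mem_product, Finset.mem_product, Finset.mem_product,
      Finset.mem_product, Finset.mem_product]
    simp only [mem_cls, Bool.false_eq_true, false_implies, true_implies, true_and]
    tauto
  rw [e, ← Finset.card_product, ← Finset.card_product, ← Finset.card_product, ← Finset.card_product,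
    ← Finset.card_product, ← Finset.card_product, ← e2, Finset.card_union_add_card_inter]

end TwoExit

end ZoneZ

end PercRepro
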